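import Literature.Analysis.UnboundedOperators.LumerPhillipsQuasi
import HarnessLib

/-!
# Lumer–Phillips: the range condition at ONE point `λ₀ > ω` suffices (Engel–Nagel II Prop. 3.14 (ii))

Analysis/UnboundedOperators proofs-layer file (theorems only, no definitions, no named facts).
`LumerPhillipsQuasi.lean` asks for the range condition «`λ − A` onto» at EVERY real `λ > ω`. Engel–Nagel
II Prop. 3.14 (ii): for a (quasi-)dissipative operator, surjectivity of `λ₀ − A` for ONE `λ₀ > ω` already
gives it for all `λ > ω` — by the Neumann series `λ − A = (1 + (λ − λ₀)R(λ₀))(λ₀ − A)` on `|λ − λ₀| < λ₀ − ω`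
(`‖R(λ₀)‖ ≤ 1/(λ₀ − ω)`) and a continuation along the half-line. In applications the single point is what
one has (e.g. `T + 1` onto for Kato's form operator, `range_formOperator_add_one`):

* `HilleYosida.surj_of_surj_near` — the Neumann-series step;
* `HilleYosida.surj_of_surj_at` — all `λ > ω` (induction over the ranges `(ω, ω + (3/2)^m (λ₀ − ω)]`);
* **`IsQuasiDissipativeData.of_surj_at`**, **`IsLumerPhillipsData.of_surj_at`**, and the Hilbert-space forms
  `IsQuasiDissipativeData.of_re_inner_le_of_surj_at`, **`exists_c0Semigroup_of_re_inner_le_of_surj_at`**.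

## References

* K.-J. Engel, R. Nagel, *One-Parameter Semigroups for Linear Evolution Equations* (2000), Ch. II
  Prop. 3.14 (ii), Thm. 3.15. [EngelNagel2000]
-/

noncomputable section

open NormedSpace Filter Set Metric
open scoped Topology NNReal

namespace Literature.Analysis.UnboundedOperators

namespace HilleYosida

open IsLumerPhillipsData (subMap subMap_apply)

variable {E : Type*} [NormedAddCommGroup E] [NormedSpace ℂ E] [CompleteSpace E]

/-- **Neumann-series step (Engel–Nagel II Prop. 3.14 (ii)).** If `(μ − ω)‖x‖ ≤ ‖μx − Ax‖` for all real
`μ > ω`, and `λ₀ − A` is onto for some `λ₀ > ω`, then `λ − A` is onto for every `λ` with `|λ − λ₀| < λ₀ − ω`: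
`x = R(λ₀)(1 + (λ − λ₀)R(λ₀))⁻¹ y` solves `λx − Ax = y`. [cite: EngelNagel2000, Ch. II Prop. 3.14] -/
theorem surj_of_surj_near {A : E →ₗ.[ℂ] E} {ω l₀ : ℝ} (hl₀ : ω < l₀)
    (hdiss : ∀ l : ℝ, ω < l → ∀ x : A.domain, (l - ω) * ‖(x : E)‖ ≤ ‖(l : ℂ) • (x : E) - A x‖)
    (hsurj₀ : ∀ y : E, ∃ x : A.domain, (l₀ : ℂ) • (x : E) - A x = y) {l : ℝ} (hnear : |l - l₀| < l₀ - ω)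
    (y : E) : ∃ x : A.domain, (l : ℂ) • (x : E) - A x = y := by
  have hc : 0 < l₀ - ω := sub_pos.2 hl₀
  -- `λ₀ − A` is bijective; its inverse `R₀` is bounded by `1/(λ₀ − ω)`
  have hinj : Function.Injective (subMap A l₀) := by
    refine (injective_iff_map_eq_zero _).2 fun x hx => ?_
    have hd := hdiss l₀ hl₀ x
    rw [← subMap_apply, hx, norm_zero] at hd
    have hx0 : ‖(x : E)‖ = 0 := le_antisymm (by nlinarith [norm_nonneg (x : E)]) (norm_nonneg _)
    exact Subtype.ext (norm_eq_zero.1 hx0)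
  have hbij : Function.Bijective (subMap A l₀) := ⟨hinj, fun y => by obtain ⟨x, hx⟩ := hsurj₀ y; exact ⟨x, hx⟩⟩
  set e₀ := LinearEquiv.ofBijective (subMap A l₀) hbij with he₀
  set R₀lin : E →ₗ[ℂ] E := A.domain.subtype.comp e₀.symm.toLinearMap with hR₀lin
  have hR₀sub : ∀ y : E, subMap A l₀ (e₀.symm y) = y := fun y => by
    have h1 := e₀.apply_symm_apply y
    rwa [he₀, LinearEquiv.ofBijective_apply] at h1
  have hR₀bound : ∀ y : E, ‖R₀lin y‖ ≤ (l₀ - ω)⁻¹ * ‖y‖ := fun y => by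
    have hd := hdiss l₀ hl₀ (e₀.symm y)
    rw [← subMap_apply, hR₀sub y] at hd
    rw [inv_mul_eq_div, le_div_iff₀ hc, mul_comm]
    exact hd
  set R₀ : E →L[ℂ] E := LinearMap.mkContinuous R₀lin (l₀ - ω)⁻¹ hR₀bound with hR₀
  have hR₀norm : ‖R₀‖ ≤ (l₀ - ω)⁻¹ := LinearMap.mkContinuous_norm_le _ (inv_nonneg.2 hc.le) _
  have hR₀apply : ∀ y : E, R₀ y = ((e₀.symm y : A.domain) : E) := fun y => rfl
  -- the Neumann series for `1 + (λ − λ₀)R₀ = 1 − t`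
  set t : E →L[ℂ] E := -(((l - l₀ : ℝ) : ℂ) • R₀) with ht
  have htn : ‖t‖ < 1 := by
    rw [ht, norm_neg]
    calc ‖((l - l₀ : ℝ) : ℂ) • R₀‖ ≤ ‖((l - l₀ : ℝ) : ℂ)‖ * ‖R₀‖ := (norm_smul ((l - l₀ : ℝ) : ℂ) R₀).le
      _ ≤ |l - l₀| * (l₀ - ω)⁻¹ := by
          rw [Complex.norm_real, Real.norm_eq_abs]; exact mul_le_mul_of_nonneg_left hR₀norm (abs_nonneg _)
      _ < (l₀ - ω) * (l₀ - ω)⁻¹ := mul_lt_mul_of_pos_right hnear (inv_pos.2 hc)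
      _ = 1 := mul_inv_cancel₀ hc.ne'
  set U := Units.oneSub t htn with hU
  set u : E := ((U⁻¹ : (E →L[ℂ] E)ˣ) : E →L[ℂ] E) y with hu
  have hUu : (1 - t) u = y := by
    have h1 := congrArg (fun S : E →L[ℂ] E => S y) U.mul_inv
    simp only [ContinuousLinearMap.mul_def, ContinuousLinearMap.comp_apply, one_apply_eq_self, hU, Units.val_oneSub] at h1
    rw [hu, hU]
    exact h1
  -- the solution `x = R₀ u`
  refine ⟨e₀.symm u, ?_⟩
  have hsplit : (l : ℂ) • ((e₀.symm u : A.domain) : E) - A (e₀.symm u) =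
      ((l - l₀ : ℝ) : ℂ) • ((e₀.symm u : A.domain) : E) + subMap A l₀ (e₀.symm u) := by
    rw [subMap_apply]; push_cast; rw [sub_smul]; abel
  rw [hsplit, hR₀sub u, ← hR₀apply u]
  -- `(λ − λ₀)R₀ u + u = (1 − t) u = y`
  rw [← hUu, ht, sub_apply, neg_apply, smul_apply, one_apply_eq_self]
  abel

/-- **The range condition at one point gives it on the whole half-line** (Engel–Nagel II Prop. 3.14 (ii)):
quasi-dissipativity for all `λ > ω` and `λ₀ − A` onto for ONE `λ₀ > ω` ⇒ `λ − A` onto for ALL `λ > ω`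
(continuation along `(ω, ω + (3/2)^m(λ₀ − ω)]`, `m = 0, 1, 2, …`). [cite: EngelNagel2000, Ch. II Prop. 3.14] -/
theorem surj_of_surj_at {A : E →ₗ.[ℂ] E} {ω l₀ : ℝ} (hl₀ : ω < l₀)
    (hdiss : ∀ l : ℝ, ω < l → ∀ x : A.domain, (l - ω) * ‖(x : E)‖ ≤ ‖(l : ℂ) • (x : E) - A x‖)
    (hsurj₀ : ∀ y : E, ∃ x : A.domain, (l₀ : ℂ) • (x : E) - A x = y) {l : ℝ} (hl : ω < l)
    (y : E) : ∃ x : A.domain, (l : ℂ) • (x : E) - A x = y := by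
  have hc : 0 < l₀ - ω := sub_pos.2 hl₀
  -- `P m`: onto for all `λ ∈ (ω, ω + (3/2)^m (λ₀ − ω)]`
  have hP : ∀ m : ℕ, ∀ l : ℝ, ω < l → l ≤ ω + (3 / 2 : ℝ) ^ m * (l₀ - ω) →
      ∀ y : E, ∃ x : A.domain, (l : ℂ) • (x : E) - A x = y := by
    intro m
    induction m with
    | zero =>
      intro l hl hle y
      rw [pow_zero, one_mul, add_sub_cancel] at hle
      refine surj_of_surj_near hl₀ hdiss hsurj₀ ?_ y
      rw [abs_sub_comm, abs_of_nonneg (sub_nonneg.2 hle)]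
      linarith
    | succ m ih =>
      intro l hl hle y
      by_cases hcase : l ≤ ω + (3 / 2 : ℝ) ^ m * (l₀ - ω)
      · exact ih l hl hcase y
      · push Not at hcase
        set l' : ℝ := ω + (3 / 2 : ℝ) ^ m * (l₀ - ω) with hl'
        have hpow : 0 < (3 / 2 : ℝ) ^ m * (l₀ - ω) := by positivity
        have hl'ω : ω < l' := by rw [hl']; linarith
        have hsurj' : ∀ y : E, ∃ x : A.domain, (l' : ℂ) • (x : E) - A x = y := ih l' hl'ω le_rfl
        refine surj_of_surj_near hl'ω hdiss hsurj' ?_ y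
        rw [abs_of_nonneg (sub_nonneg.2 hcase.le)]
        have : l - l' ≤ (3 / 2 : ℝ) ^ (m + 1) * (l₀ - ω) - (3 / 2 : ℝ) ^ m * (l₀ - ω) := by rw [hl']; linarith
        calc l - l' ≤ (3 / 2 : ℝ) ^ (m + 1) * (l₀ - ω) - (3 / 2 : ℝ) ^ m * (l₀ - ω) := this
          _ = (1 / 2) * ((3 / 2 : ℝ) ^ m * (l₀ - ω)) := by ring
          _ < (3 / 2 : ℝ) ^ m * (l₀ - ω) := by linarith
          _ = l' - ω := by rw [hl']; ring
  obtain ⟨m, hm⟩ := pow_unbounded_of_one_lt ((l - ω) / (l₀ - ω)) (by norm_num : (1 : ℝ) < 3 / 2)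
  refine hP m l hl ?_ y
  rw [div_lt_iff₀ hc] at hm
  linarith

/-- **Quasi-dissipative data from the range condition at ONE point.** [cite: EngelNagel2000, Ch. II Prop. 3.14] -/
theorem IsQuasiDissipativeData.of_surj_at {A : E →ₗ.[ℂ] E} {ω l₀ : ℝ} (hd : Dense (A.domain : Set E))
    (hdiss : ∀ l : ℝ, ω < l → ∀ x : A.domain, (l - ω) * ‖(x : E)‖ ≤ ‖(l : ℂ) • (x : E) - A x‖)
    (hl₀ : ω < l₀) (hsurj₀ : ∀ y : E, ∃ x : A.domain, (l₀ : ℂ) • (x : E) - A x = y) :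
    IsQuasiDissipativeData A ω where
  dense := hd
  dissipative := hdiss
  surj _ hl y := surj_of_surj_at hl₀ hdiss hsurj₀ hl y

/-- **Lumer–Phillips data from the range condition at ONE point** (`λ₀ − A` onto for one `λ₀ > 0`).
[cite: EngelNagel2000, Ch. II Thm. 3.15] -/
theorem IsLumerPhillipsData.of_surj_at {A : E →ₗ.[ℂ] E} {l₀ : ℝ} (hd : Dense (A.domain : Set E))
    (hdiss : ∀ l : ℝ, 0 < l → ∀ x : A.domain, l * ‖(x : E)‖ ≤ ‖(l : ℂ) • (x : E) - A x‖)
    (hl₀ : 0 < l₀) (hsurj₀ : ∀ y : E, ∃ x : A.domain, (l₀ : ℂ) • (x : E) - A x = y) :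
    IsLumerPhillipsData A where
  dense := hd
  dissipative := hdiss
  surj _ hl y := surj_of_surj_at (ω := 0) hl₀ (fun l hl x => by rw [sub_zero]; exact hdiss l hl x) hsurj₀ hl y

/-! ### Hilbert space -/

section Hilbert

variable {H : Type*} [NormedAddCommGroup H] [InnerProductSpace ℂ H] [CompleteSpace H]

/-- **Numerical range + range condition at one point** ⇒ quasi-dissipative data. [cite: EngelNagel2000, Ch. II Prop. 3.14] -/
theorem IsQuasiDissipativeData.of_re_inner_le_of_surj_at {A : H →ₗ.[ℂ] H} {ω l₀ : ℝ}
    (hd : Dense (A.domain : Set H)) (hre : ∀ x : A.domain, (inner ℂ (A x) (x : H)).re ≤ ω * ‖(x : H)‖ ^ 2)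
    (hl₀ : ω < l₀) (hsurj₀ : ∀ y : H, ∃ x : A.domain, (l₀ : ℂ) • (x : H) - A x = y) :
    IsQuasiDissipativeData A ω :=
  IsQuasiDissipativeData.of_surj_at hd (fun l _ x => quasiDissipative_of_re_inner_le hre l x) hl₀ hsurj₀

/-- **Generation from the numerical range with the range condition at ONE point** (Hilbert space): dense
`D(A)`, `Re⟪Ax, x⟫ ≤ ω‖x‖²` and `λ₀ − A` onto for one real `λ₀ > ω` ⇒ `∃ T`, `‖T(t)‖ ≤ e^{ωt}`, `T.generator = A`.
[cite: EngelNagel2000, Ch. II Thm. 3.15] -/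
theorem exists_c0Semigroup_of_re_inner_le_of_surj_at {A : H →ₗ.[ℂ] H} {ω l₀ : ℝ}
    (hd : Dense (A.domain : Set H)) (hre : ∀ x : A.domain, (inner ℂ (A x) (x : H)).re ≤ ω * ‖(x : H)‖ ^ 2)
    (hl₀ : ω < l₀) (hsurj₀ : ∀ y : H, ∃ x : A.domain, (l₀ : ℂ) • (x : H) - A x = y) :
    ∃ T : C0Semigroup ℂ H, (∀ t : ℝ≥0, ‖T.app t‖ ≤ Real.exp (ω * t)) ∧ T.generator = A := by
  obtain ⟨T, hT, -, hgen⟩ := (IsQuasiDissipativeData.of_re_inner_le_of_surj_at hd hre hl₀ hsurj₀).exists_c0Semigroup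
  exact ⟨T, hT, hgen⟩

end Hilbert

end HilleYosida

end Literature.Analysis.UnboundedOperators
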